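import Literature.Computability.QuantumComplexity.DyadicMatrices
import HarnessLib

/-!
# The net compiler: the program and its correctness (effective compiler, III)

Third file of the effective (exponential-time, polynomial-accuracy) gate compiler behind the named
fact `PromiseBQPOver_eq_PromiseBQP`. Here is the ALGORITHM, as a mathematical functional program on
the Gaussian-integer matrices of `DyadicMatrices.lean`, and its correctness. It is the brute-force
construction of an `ε`-net of the group generated by finitely many unitaries ("the initial net" of
Dawson–Nielsen 2006, §5, which the Solovay–Kitaev recursion would then refine — polynomiality in
`1/ε` is all that gate-set independence needs, so the recursion is not implemented):

* `Params m` — precision `p`, separation threshold `1/T`, generator matrices `gens` (approximations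
  at precision `p` of unitaries `a i`, `Params.Approximates`); `Elem m = List ℕ × GMat m` (a word over
  the generator indices and the stored approximation of its matrix, `wmat a w = a w_L ⋯ a w₁`).
* **The program**: `cand X i = clamp ⌊gensᵢ X / 2ᵖ⌋` (represents `aᵢ X̂`); `step` — one round on the
  state `(pointer, net)`: if some candidate of the pointed element is far (`closeTest` fails) from
  every stored matrix, append the first such candidate, else advance the pointer; `run R = step^[R]`
  from `init = (0, [([], 2ᵖ • 1)])`; `lookup TT net tgt` — the word of the first stored matrix within
  `1/TT` of the target; `compile R TT tgt`.
* **The invariant** `Inv` (`inv_init`, `Inv.step`, `inv_run`): the empty word is stored; the pointer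
  is within the net; words use genuine generators and have length `≤ r`; stored matrices have
  bounded entries (`EntryBound`, the clamp being inactive: `fro_hat_cand_sub_le`) and represent their
  word matrices within `|w| ρ`, `ρ = (2ᵐ + 1) η + 2·2ᵐ/2ᵖ` (the error recurrence); stored matrices
  are pairwise far; every processed element has all its candidates close to the net.
* **Packing** (`Inv.length_le`): pairwise far matrices with bounded entries are at most
  `packBound h = (2B/h + 1)^{2·4ᵐ}` (grid cells, `DyadicMatrices.length_le_of_pairwise_far`).
* **Progress** (`run_complete`): an active round increases `pointer + size` by one, so after
  `R ≥ 2 · packBound` rounds every stored element has been processed.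
* **Closure ⇒ approximation of all words** (`Inv.exists_phaseDist_wmat_le`): in a complete net
  every word `v` over the generators has a stored element within `|v| θ` up to phase,
  `θ = 1/T + 2(R+1)ρ` (induction on `v`: left unitary invariance of the phase-invariant distance,
  the closure property, the triangle inequality).
* **The lookup** (`lookup_spec`) and the summary `run_spec`, **`compile_spec`**: under adequate
  parameters (`Params.Good`), if some word over the generators is close to the unitary `U`
  represented by the target (the Solovay–Kitaev input), the compiled word `w` satisfies
  `D(U, wmat w) ≤ 1/TT + η_T + (R + 1) ρ`, uses genuine generators and has length `≤ R`.

Everything is proved; no named facts. The program is mirrored on codes (polynomial time in the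
unary budget) in `EffectiveCompilerCodes.lean` / `EffectiveCompilerFP.lean`, and its parameters are
chosen in `EffectiveCompiler.lean`.

## References

* C. M. Dawson, M. A. Nielsen, *The Solovay–Kitaev algorithm*, Quantum Inf. Comput. 6 (2006),
  Thm. 1, §3 (nets up to phase), §5 (the initial `ε`-net: construction and size) [DawsonNielsen2006].
* M. A. Nielsen, I. L. Chuang, *Quantum Computation and Quantum Information*, CUP 2010, §4.5.3
  (Box 4.1: chaining of approximation errors), App. 3 [NielsenChuang2010].
* A. Yu. Kitaev, A. H. Shen, M. N. Vyalyi, *Classical and Quantum Computation*, AMS 2002, §8.3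
  (efficient approximation over a fixed basis via nets) [KitaevShenVyalyi2002].
-/

noncomputable section

namespace Literature.Computability.QuantumComplexity

open Matrix Cryptography PhaseFrobenius GaussianInt

namespace NetCompiler

variable {m : ℕ}

/-! ### Words and their matrices -/

/-- **The matrix of a word** of generator indices, applied in order (the first index acts first,
as the gates of a circuit: `wmat a [i₁, …, i_L] = a i_L ⋯ a i₁`). [cite: NielsenChuang2010, §4.2] -/
def wmat (a : ℕ → Matrix (QReg m) (QReg m) ℂ) (w : List ℕ) : Matrix (QReg m) (QReg m) ℂ :=
  (w.reverse.map a).prod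

/-- The empty word is the identity. [folklore] -/
@[simp] theorem wmat_nil (a : ℕ → Matrix (QReg m) (QReg m) ℂ) : wmat a [] = 1 := by simp [wmat]

/-- Appending an index multiplies on the left. [folklore] -/
theorem wmat_append_singleton (a : ℕ → Matrix (QReg m) (QReg m) ℂ) (w : List ℕ) (i : ℕ) :
    wmat a (w ++ [i]) = a i * wmat a w := by
  simp [wmat]

/-- Words over unitary generators are unitary. [folklore] -/
theorem wmat_mem_unitaryGroup {a : ℕ → Matrix (QReg m) (QReg m) ℂ} {w : List ℕ}
    (h : ∀ i ∈ w, a i ∈ Matrix.unitaryGroup (QReg m) ℂ) : wmat a w ∈ Matrix.unitaryGroup (QReg m) ℂ := by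
  induction w using List.reverseRecOn with
  | nil => rw [wmat_nil]; exact Submonoid.one_mem _
  | append_singleton w i ih =>
    rw [wmat_append_singleton]
    exact Submonoid.mul_mem _ (h i (by simp)) (ih fun j hj => h j (by simp [hj]))

/-! ### The program -/

/-- **Parameters of a run of the net compiler**: the precision `p` (scale `2ᵖ`), the separation
threshold `1/T` of the closeness test, and the generator matrices (Gaussian-integer
approximations at precision `p` of the placement unitaries). [folklore] -/
structure Params (m : ℕ) where
  /-- precision: entries are scaled by `2ᵖ` -/
  p : ℕ
  /-- the closeness test is `D ≤ 1/T` -/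
  T : ℕ
  /-- the generators, at precision `p` -/
  gens : List (GMat m)

/-- An element of the net: a word and the stored approximation of its matrix. [folklore] -/
abbrev Elem (m : ℕ) : Type := List ℕ × GMat m

namespace Params

variable (P : Params m)

/-- The clamp bound `(2ᵐ + 1) · 2ᵖ` (never active on genuine data: stored matrices represent
matrices of Frobenius norm `≤ 2ᵐ + 1`). [folklore] -/
def B : ℤ := (((Fintype.card (QReg m) + 1) * 2 ^ P.p : ℕ) : ℤ)

/-- The scaled identity `2ᵖ • 1`, the stored matrix of the empty word. [folklore] -/
def one : GMat m := ((2 ^ P.p : ℕ) : GaussianInt) • (1 : GMat m)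

/-- **The candidate** obtained from a stored matrix `X` and the generator `i`: the clamped
rounded product `clamp ⌊gensᵢ X / 2ᵖ⌋` (it represents `aᵢ X̂`). [cite: DawsonNielsen2006, §5] -/
def cand (X : GMat m) (i : ℕ) : GMat m := clampMat P.B (roundMul P.p (P.gens.getD i 0) X)

/-- A matrix is **far from the net** if the closeness test fails against every stored matrix. [folklore] -/
def isFar (net : List (Elem m)) (Y : GMat m) : Bool := net.all fun e => !closeTest P.p P.T Y e.2

/-- The candidates of an element that are far from the net, in the order of the generators. [folklore] -/
def farCands (net : List (Elem m)) (e : Elem m) : List (Elem m) :=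
  ((List.range P.gens.length).map fun i => (e.1 ++ [i], P.cand e.2 i)).filter fun c => P.isFar net c.2

/-- **One round of the net construction.** The state is a pointer and the net. If the pointer is
inside the net, look at the element it points to: if one of its candidates is far from the whole
net, append the first such candidate (the pointer stays); otherwise all its candidates are close
to the net and the pointer advances. If the pointer is past the net, nothing happens.
[cite: DawsonNielsen2006, §5 (construction of the initial net)] -/
def step (st : ℕ × List (Elem m)) : ℕ × List (Elem m) :=
  if st.1 < st.2.length then
    match P.farCands st.2 (st.2.getD st.1 ([], 0)) with
    | [] => (st.1 + 1, st.2)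
    | c :: _ => (st.1, st.2 ++ [c])
  else st

/-- The initial state: pointer `0`, net `[([], 2ᵖ • 1)]`. [folklore] -/
def init : ℕ × List (Elem m) := (0, [([], P.one)])

/-- **The run of `R` rounds.** [folklore] -/
def run (R : ℕ) : ℕ × List (Elem m) := P.step^[R] P.init

/-- **The lookup**: the word of the first stored matrix passing the closeness test `D ≤ 1/TT`
against the target (the empty word if none does). [cite: DawsonNielsen2006, §5] -/
def lookup (TT : ℕ) (net : List (Elem m)) (tgt : GMat m) : List ℕ :=
  match net.filter fun e => closeTest P.p TT tgt e.2 with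
  | [] => []
  | e :: _ => e.1

/-! ### Semantics of the generators -/

/-- **The generator matrices approximate unitaries**: generator `i < |gens|` represents, at
precision `p`, a matrix within `η` (Frobenius) of the unitary `a i`. [folklore] -/
structure Approximates (a : ℕ → Matrix (QReg m) (QReg m) ℂ) (η : ℝ) : Prop where
  /-- the tolerance is nonnegative -/
  nonneg : 0 ≤ η
  /-- the represented unitaries -/
  unitary : ∀ i < P.gens.length, a i ∈ Matrix.unitaryGroup (QReg m) ℂ
  /-- the approximation -/
  approx : ∀ i < P.gens.length, fro (hat P.p (P.gens.getD i 0) - a i) ≤ η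

/-- The per-letter error `ρ = (2ᵐ + 1) η + 2 · 2ᵐ / 2ᵖ` of the error recurrence. [folklore] -/
def rho (η : ℝ) : ℝ := (Fintype.card (QReg m) + 1) * η + 2 * Fintype.card (QReg m) / 2 ^ P.p

/-- `ρ ≥ 0` for `η ≥ 0`. [folklore] -/
theorem rho_nonneg {η : ℝ} (hη : 0 ≤ η) : 0 ≤ P.rho η := by unfold rho; positivity

variable {P}

/-- **The candidate represents the next word matrix.** If `X̂` is within `e ≤ 1` of the unitary
`M` then (the clamp being inactive) `cand X i` represents `aᵢ M` within `e + ρ`.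
[cite: NielsenChuang2010, §4.5.3 Box 4.1 (chaining of errors)] -/
theorem fro_hat_cand_sub_le {a : ℕ → Matrix (QReg m) (QReg m) ℂ} {η : ℝ} (hP : P.Approximates a η)
    {i : ℕ} (hi : i < P.gens.length) {X : GMat m} {M : Matrix (QReg m) (QReg m) ℂ}
    (hM : M ∈ Matrix.unitaryGroup (QReg m) ℂ) {e : ℝ} (hX : fro (hat P.p X - M) ≤ e) (he : e + P.rho η ≤ 1) :
    fro (hat P.p (P.cand X i) - a i * M) ≤ e + P.rho η := by
  have hη : 0 ≤ η := hP.nonneg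
  have he0 : 0 ≤ e := (fro_nonneg _).trans hX
  have hrho := P.rho_nonneg hη
  have hraw : fro (hat P.p (roundMul P.p (P.gens.getD i 0) X) - a i * M) ≤ e + P.rho η := by
    refine (fro_hat_roundMul_sub_mul_le P.p (hP.unitary i hi) hM (hP.approx i hi) hX).trans ?_
    unfold rho
    have hcard : (0 : ℝ) ≤ Fintype.card (QReg m) := Nat.cast_nonneg _
    have he1 : e ≤ 1 := by linarith
    nlinarith [mul_le_mul_of_nonneg_right he1 hη]
  -- the clamp is inactive: the rounded product represents a matrix of norm `≤ 2ᵐ + 1`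
  have hbd : EntryBound P.B (roundMul P.p (P.gens.getD i 0) X) := by
    refine entryBound_of_fro_hat_le (p := P.p) (r := Fintype.card (QReg m) + 1) ?_ ?_
    · calc fro (hat P.p (roundMul P.p (P.gens.getD i 0) X))
          ≤ fro (hat P.p (roundMul P.p (P.gens.getD i 0) X) - a i * M) + fro (a i * M) := fro_le_fro_sub_add _ _
        _ ≤ (e + P.rho η) + Fintype.card (QReg m) :=
            add_le_add hraw (fro_le_card_of_mem_unitaryGroup (Submonoid.mul_mem _ (hP.unitary i hi) hM))
        _ ≤ Fintype.card (QReg m) + 1 := by linarith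
    · rw [B]; push_cast; exact le_rfl
  rw [cand, clampMat_of_entryBound hbd]
  exact hraw

/-! ### The invariant -/

/-- **The invariant of the net construction** after `r` rounds, for generators approximating the
unitaries `a` within `η`. [cite: DawsonNielsen2006, §5] -/
structure Inv (P : Params m) (a : ℕ → Matrix (QReg m) (QReg m) ℂ) (η : ℝ) (r : ℕ) (st : ℕ × List (Elem m)) :
    Prop where
  /-- the empty word is stored -/
  nil_mem : ([], P.one) ∈ st.2
  /-- the pointer is inside or at the end of the net -/
  ptr_le : st.1 ≤ st.2.length
  /-- words use genuine generators -/
  idx_lt : ∀ e ∈ st.2, ∀ i ∈ e.1, i < P.gens.length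
  /-- words are short -/
  len_le : ∀ e ∈ st.2, e.1.length ≤ r
  /-- stored matrices have bounded entries -/
  bound : ∀ e ∈ st.2, EntryBound P.B e.2
  /-- stored matrices represent their word matrices -/
  err : ∀ e ∈ st.2, fro (hat P.p e.2 - wmat a e.1) ≤ e.1.length * P.rho η
  /-- stored matrices are pairwise far -/
  far : st.2.Pairwise fun e e' => closeTest P.p P.T e'.2 e.2 = false
  /-- processed elements have all their candidates close to the net -/
  closed : ∀ j < st.1, ∀ i < P.gens.length, ∃ e' ∈ st.2, closeTest P.p P.T (P.cand (st.2.getD j ([], 0)).2 i) e'.2 = true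

/-- The stored identity represents the identity exactly. [folklore] -/
theorem hat_one (P : Params m) : hat P.p P.one = (1 : Matrix (QReg m) (QReg m) ℂ) := hat_scaledOne P.p

/-- `2ᵖ ≤ B`. [folklore] -/
theorem pow_le_B (P : Params m) : ((2 ^ P.p : ℕ) : ℤ) ≤ P.B := by
  rw [B]; exact_mod_cast Nat.le_mul_of_pos_left _ (Nat.succ_pos _)

/-- `0 ≤ B`. [folklore] -/
theorem B_nonneg (P : Params m) : (0 : ℤ) ≤ P.B := le_trans (by positivity) P.pow_le_B

/-- The stored identity has bounded entries. [folklore] -/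
theorem entryBound_one (P : Params m) : EntryBound P.B P.one := by
  have hSB := P.pow_le_B
  have hB := P.B_nonneg
  intro i j
  by_cases hij : i = j
  · subst hij
    have hre : (P.one i i).re = ((2 ^ P.p : ℕ) : ℤ) := by
      simp only [one, Matrix.smul_apply, Matrix.one_apply_eq, smul_eq_mul, mul_one, Zsqrtd.re_natCast]
    have him : (P.one i i).im = 0 := by
      simp only [one, Matrix.smul_apply, Matrix.one_apply_eq, smul_eq_mul, mul_one, Zsqrtd.im_natCast]
    rw [hre, him]
    exact ⟨by rw [abs_of_nonneg (by positivity)]; exact hSB, by simpa using hB⟩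
  · have h0 : P.one i j = 0 := by
      simp only [one, Matrix.smul_apply, Matrix.one_apply_ne hij, smul_zero]
    rw [h0]
    exact ⟨by simpa using hB, by simpa using hB⟩

/-- **The invariant holds initially.** [folklore] -/
theorem inv_init (P : Params m) (a : ℕ → Matrix (QReg m) (QReg m) ℂ) (η : ℝ) : Inv P a η 0 P.init where
  nil_mem := List.mem_singleton.2 rfl
  ptr_le := Nat.zero_le _
  idx_lt e he i hi := by
    obtain rfl : e = ([], P.one) := List.mem_singleton.1 he
    simp at hi
  len_le e he := by
    obtain rfl : e = ([], P.one) := List.mem_singleton.1 he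
    simp
  bound e he := by
    obtain rfl : e = ([], P.one) := List.mem_singleton.1 he
    exact entryBound_one P
  err e he := by
    obtain rfl : e = ([], P.one) := List.mem_singleton.1 he
    simp [hat_one]
  far := List.pairwise_singleton _ _
  closed j hj := absurd hj (Nat.not_lt_zero _)

/-- The far candidates are candidates of the element, far from the net. [folklore] -/
theorem mem_farCands_iff {net : List (Elem m)} {e c : Elem m} :
    c ∈ P.farCands net e ↔ ∃ i < P.gens.length, c = (e.1 ++ [i], P.cand e.2 i) ∧ P.isFar net c.2 = true := by
  simp only [farCands, List.mem_filter, List.mem_map, List.mem_range]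
  constructor
  · rintro ⟨⟨i, hi, rfl⟩, hfar⟩; exact ⟨i, hi, rfl, hfar⟩
  · rintro ⟨i, hi, rfl, hfar⟩; exact ⟨⟨i, hi, rfl⟩, hfar⟩

/-- `isFar` means the test fails against every stored matrix. [folklore] -/
theorem isFar_eq_true_iff {net : List (Elem m)} {Y : GMat m} :
    P.isFar net Y = true ↔ ∀ e ∈ net, closeTest P.p P.T Y e.2 = false := by
  simp [isFar]

/-- **The invariant is preserved by a round** (as long as the accumulated error stays `≤ 1`, so
that the clamp is inactive). [cite: DawsonNielsen2006, §5] -/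
theorem Inv.step {a : ℕ → Matrix (QReg m) (QReg m) ℂ} {η : ℝ} (hP : P.Approximates a η) {r : ℕ}
    {st : ℕ × List (Elem m)} (h : Inv P a η r st) (hr : (r + 1) * P.rho η ≤ 1) : Inv P a η (r + 1) (P.step st) := by
  obtain ⟨ptr, net⟩ := st
  have hrho := P.rho_nonneg hP.nonneg
  have hmono : Inv P a η (r + 1) (ptr, net) :=
    { h with len_le := fun e he => (h.len_le e he).trans (Nat.le_succ r) }
  unfold Params.step
  dsimp only
  split_ifs with hlt
  · set e := net.getD ptr ([], 0) with he_def
    have he_mem : e ∈ net := by rw [he_def, List.getD_eq_getElem _ _ hlt]; exact List.getElem_mem hlt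
    rcases hfc : P.farCands net e with _ | ⟨c, cs⟩
    · -- every candidate of `e` is close to the net: the pointer advances
      dsimp only
      exact
        { hmono with
          ptr_le := hlt
          closed := fun j hj i hi => by
            rcases Nat.lt_succ_iff_lt_or_eq.1 hj with hj' | hj'
            · exact h.closed j hj' i hi
            · rw [hj', ← he_def]
              have hnot : ¬ (P.isFar net (P.cand e.2 i) = true) := by
                  intro hfar
                  have hmem : (e.1 ++ [i], P.cand e.2 i) ∈ P.farCands net e :=
                    mem_farCands_iff.2 ⟨i, hi, rfl, hfar⟩
                  rw [hfc] at hmem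
                  simp at hmem
              rw [isFar_eq_true_iff] at hnot
              push Not at hnot
              obtain ⟨e', he', hne⟩ := hnot
              exact ⟨e', he', by simpa using hne⟩ }
    · -- the first far candidate `c` is appended
      dsimp only
      have hc : c ∈ P.farCands net e := by rw [hfc]; exact List.mem_cons_self
      obtain ⟨i, hi, rfl, hfar⟩ := mem_farCands_iff.1 hc
      rw [isFar_eq_true_iff] at hfar
      have herr_e := h.err e he_mem
      have hlen_e := h.len_le e he_mem
      have hunit : wmat a e.1 ∈ Matrix.unitaryGroup (QReg m) ℂ :=
        wmat_mem_unitaryGroup fun j hj => hP.unitary j (h.idx_lt e he_mem j hj)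
      have hbound_e : (e.1.length : ℝ) * P.rho η + P.rho η ≤ 1 := by
        have h1 : (e.1.length : ℝ) ≤ r := by exact_mod_cast hlen_e
        have h2 : ((r : ℝ) + 1) * P.rho η ≤ 1 := by exact_mod_cast hr
        nlinarith
      have hnew : fro (hat P.p (P.cand e.2 i) - a i * wmat a e.1) ≤ e.1.length * P.rho η + P.rho η :=
        fro_hat_cand_sub_le hP hi hunit herr_e hbound_e
      exact
        { nil_mem := List.mem_append_left _ h.nil_mem
          ptr_le := by rw [List.length_append, List.length_singleton]; exact Nat.le_succ_of_le h.ptr_le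
          idx_lt := fun e' he' j hj => by
            rw [List.mem_append, List.mem_singleton] at he'
            rcases he' with he' | rfl
            · exact h.idx_lt e' he' j hj
            · simp only [List.mem_append, List.mem_singleton] at hj
              rcases hj with hj | rfl
              · exact h.idx_lt e he_mem j hj
              · exact hi
          len_le := fun e' he' => by
            rw [List.mem_append, List.mem_singleton] at he'
            rcases he' with he' | rfl
            · exact (h.len_le e' he').trans (Nat.le_succ r)
            · rw [List.length_append, List.length_singleton]; exact Nat.succ_le_succ hlen_e
          bound := fun e' he' => by
            rw [List.mem_append, List.mem_singleton] at he'
            rcases he' with he' | rfl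
            · exact h.bound e' he'
            · exact entryBound_clampMat P.B_nonneg _
          err := fun e' he' => by
            rw [List.mem_append, List.mem_singleton] at he'
            rcases he' with he' | rfl
            · exact h.err e' he'
            · dsimp only
              rw [wmat_append_singleton, List.length_append, List.length_singleton]
              push_cast
              rw [add_mul, one_mul]
              exact hnew
          far := List.pairwise_append.2 ⟨h.far, List.pairwise_singleton _ _, fun x hx y hy => by
            obtain rfl : y = (e.1 ++ [i], P.cand e.2 i) := List.mem_singleton.1 hy
            exact hfar x hx⟩
          closed := fun j hj i' hi' => by
            obtain ⟨e', he', ht⟩ := h.closed j hj i' hi'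
            refine ⟨e', List.mem_append_left _ he', ?_⟩
            rwa [List.getD_append _ _ _ _ (lt_of_lt_of_le hj h.ptr_le)] }
  · exact hmono


/-- The invariant only gets weaker as the round count grows. [folklore] -/
theorem Inv.mono {a : ℕ → Matrix (QReg m) (QReg m) ℂ} {η : ℝ} {r r' : ℕ} {st : ℕ × List (Elem m)}
    (h : Inv P a η r st) (hr : r ≤ r') : Inv P a η r' st :=
  { h with len_le := fun e he => (h.len_le e he).trans hr }

/-- Unfolding one more round. [folklore] -/
theorem run_succ (R : ℕ) : P.run (R + 1) = P.step (P.run R) := Function.iterate_succ_apply' _ _ _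

/-- **The invariant holds along the run**, as long as `R ρ ≤ 1`. [cite: DawsonNielsen2006, §5] -/
theorem inv_run {a : ℕ → Matrix (QReg m) (QReg m) ℂ} {η : ℝ} (hP : P.Approximates a η) {R : ℕ}
    (hR : R * P.rho η ≤ 1) : ∀ r ≤ R, Inv P a η r (P.run r) := by
  intro r hr
  induction r with
  | zero => exact inv_init P a η
  | succ r ih =>
    rw [run_succ]
    refine (ih (Nat.le_of_succ_le hr)).step hP ?_
    have h1 : ((r : ℝ) + 1) ≤ R := by exact_mod_cast hr
    have hρ := P.rho_nonneg hP.nonneg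
    nlinarith

/-! ### Packing: the net stays small -/

/-- **The packing bound** `(2B/h + 1)^{2·4ᵐ}` on the size of a net whose stored matrices are
pairwise far, at mesh `h`. [cite: DawsonNielsen2006, §5 (counting the net)] -/
def packBound (h : ℕ) : ℕ := ((2 * P.B / h).toNat + 1) ^ (2 * (Fintype.card (QReg m) * Fintype.card (QReg m)))

/-- A failed closeness test separates the represented matrices in Frobenius norm by `2ᵖ / T`. [folklore] -/
theorem fro_cplx_sub_gt_of_closeTest_eq_false {T : ℕ} (hT : 0 < T) {X Y : GMat m}
    (h : closeTest P.p T X Y = false) : (2 : ℝ) ^ P.p / T < fro (cplx X - cplx Y) := by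
  have h' : ¬ phaseDist (hat P.p X) (hat P.p Y) ≤ 1 / T := by
    rw [← closeTest_eq_true_iff hT, h]; exact Bool.false_ne_true
  push Not at h'
  have h2 := h'.trans_le (phaseDist_le_fro_sub _ _)
  rw [fro_hat_sub, lt_div_iff₀ (two_pow_pos' _)] at h2
  rw [div_lt_iff₀ (by exact_mod_cast hT)]
  calc (2 : ℝ) ^ P.p = 1 / T * 2 ^ P.p * T := by field_simp
    _ < fro (cplx X - cplx Y) * T := by gcongr

/-- **The net is small**: under the invariant, with a mesh `h ≥ 1` such that `2 · 2ᵐ · h · T ≤ 2ᵖ`,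
the net has at most `packBound h` elements. [cite: DawsonNielsen2006, §5] -/
theorem Inv.length_le {a : ℕ → Matrix (QReg m) (QReg m) ℂ} {η : ℝ} {r : ℕ} {st : ℕ × List (Elem m)}
    (h : Inv P a η r st) (hT : 0 < P.T) {hm : ℕ} (hh : 0 < hm)
    (hsep : 2 * (Fintype.card (QReg m) : ℝ) * hm * P.T ≤ 2 ^ P.p) : st.2.length ≤ P.packBound hm := by
  have hlen : st.2.length = (st.2.map Prod.snd).length := (List.length_map _).symm
  rw [hlen, packBound]
  refine length_le_of_pairwise_far P.B_nonneg hh (fun X hX => ?_) ?_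
  · obtain ⟨e, he, rfl⟩ := List.mem_map.1 hX
    exact h.bound e he
  · rw [List.pairwise_map]
    refine h.far.imp fun {e e'} hfar => ?_
    have hgt := P.fro_cplx_sub_gt_of_closeTest_eq_false hT hfar
    rw [fro_sub_comm] at hgt
    refine le_trans ?_ hgt.le
    rw [le_div_iff₀ (by exact_mod_cast hT)]
    exact hsep

/-! ### Progress: every element gets processed -/

/-- A round does nothing once the pointer is past the net. [folklore] -/
theorem step_of_not_lt {st : ℕ × List (Elem m)} (h : ¬ st.1 < st.2.length) : P.step st = st := by
  unfold Params.step; rw [if_neg h]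

/-- An active round increases `pointer + size` by exactly one. [folklore] -/
theorem measure_step {st : ℕ × List (Elem m)} (h : st.1 < st.2.length) :
    (P.step st).1 + (P.step st).2.length = st.1 + st.2.length + 1 := by
  unfold Params.step
  rw [if_pos h]
  rcases P.farCands st.2 (st.2.getD st.1 ([], 0)) with _ | ⟨c, cs⟩
  · dsimp only; omega
  · dsimp only; rw [List.length_append, List.length_singleton]; omega

/-- Once stuck, the run is constant. [folklore] -/
theorem run_add_of_not_lt {r : ℕ} (h : ¬ (P.run r).1 < (P.run r).2.length) : ∀ n, P.run (r + n) = P.run r := by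
  intro n
  induction n with
  | zero => rfl
  | succ n ih => rw [← add_assoc, run_succ, ih, P.step_of_not_lt h]

/-- If all rounds so far were active, `pointer + size = 1 + R`. [folklore] -/
theorem measure_run {R : ℕ} (h : ∀ r < R, (P.run r).1 < (P.run r).2.length) :
    (P.run R).1 + (P.run R).2.length = 1 + R := by
  induction R with
  | zero => rfl
  | succ R ih =>
    rw [run_succ, P.measure_step (h R (Nat.lt_succ_self R)), ih fun r hr => h r (Nat.lt_succ_of_lt hr)]
    ring

/-- **Completion**: if the pointer never exceeds the size and the size never exceeds `N`, then
after `R ≥ 2N` rounds the pointer has reached the end of the net (every stored element has been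
processed). [cite: DawsonNielsen2006, §5] -/
theorem run_complete {R N : ℕ} (hptr : ∀ r ≤ R, (P.run r).1 ≤ (P.run r).2.length)
    (hsize : ∀ r ≤ R, (P.run r).2.length ≤ N) (hR : 2 * N ≤ R) : (P.run R).1 = (P.run R).2.length := by
  by_contra hne
  have hlt : (P.run R).1 < (P.run R).2.length := lt_of_le_of_ne (hptr R le_rfl) hne
  have hall : ∀ r < R, (P.run r).1 < (P.run r).2.length := by
    intro r hr
    by_contra hstuck
    have := P.run_add_of_not_lt hstuck (R - r)
    rw [Nat.add_sub_cancel' hr.le] at this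
    rw [this] at hlt
    exact hstuck hlt
  have hm := P.measure_run hall
  have := hsize R le_rfl
  omega

/-! ### Closure and approximation of all words -/

/-- **In a complete net every candidate of every stored element is close to the net.** [folklore] -/
theorem Inv.exists_closeTest {a : ℕ → Matrix (QReg m) (QReg m) ℂ} {η : ℝ} {r : ℕ} {st : ℕ × List (Elem m)}
    (h : Inv P a η r st) (hdone : st.1 = st.2.length) {e : Elem m} (he : e ∈ st.2) {i : ℕ}
    (hi : i < P.gens.length) : ∃ e' ∈ st.2, closeTest P.p P.T (P.cand e.2 i) e'.2 = true := by
  obtain ⟨j, hj, rfl⟩ := List.getElem_of_mem he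
  have := h.closed j (hdone ▸ hj) i hi
  rwa [List.getD_eq_getElem _ _ hj] at this

/-- **The closure radius** `θ = 1/T + 2 (R + 1) ρ` of a complete net built in `R` rounds. [folklore] -/
def theta (η : ℝ) (R : ℕ) : ℝ := 1 / P.T + 2 * ((R + 1) * P.rho η)

/-- **Every word is approximated by the net up to phase**, with an error linear in its length:
for a complete net satisfying the invariant (built in `R` rounds with `(R + 1) ρ ≤ 1`), every word
`v` over the generators has a stored element `e` with `D(wmat v, wmat e.1) ≤ |v| · θ`
(induction on `v`: unitary invariance of `D`, the closure property, the triangle inequality).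
[cite: DawsonNielsen2006, §5 (the initial net is an ε-net)] -/
theorem Inv.exists_phaseDist_wmat_le {a : ℕ → Matrix (QReg m) (QReg m) ℂ} {η : ℝ} {R : ℕ}
    {st : ℕ × List (Elem m)} (hP : P.Approximates a η) (h : Inv P a η R st) (hdone : st.1 = st.2.length)
    (hT : 0 < P.T) (hR : (R + 1) * P.rho η ≤ 1) :
    ∀ v : List ℕ, (∀ i ∈ v, i < P.gens.length) →
      ∃ e ∈ st.2, phaseDist (wmat a v) (wmat a e.1) ≤ v.length * P.theta η R := by
  have hρ := P.rho_nonneg hP.nonneg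
  intro v
  induction v using List.reverseRecOn with
  | nil =>
    intro _
    exact ⟨([], P.one), h.nil_mem, by simp⟩
  | append_singleton v i ih =>
    intro hv
    have hi : i < P.gens.length := hv i (by simp)
    obtain ⟨e, he, hde⟩ := ih fun j hj => hv j (by simp [hj])
    obtain ⟨e', he', htest⟩ := h.exists_closeTest hdone he hi
    have hunit : wmat a e.1 ∈ Matrix.unitaryGroup (QReg m) ℂ :=
      wmat_mem_unitaryGroup fun j hj => hP.unitary j (h.idx_lt e he j hj)
    -- errors of the stored data
    have herr_e' : fro (hat P.p e'.2 - wmat a e'.1) ≤ (R + 1) * P.rho η := by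
      refine (h.err e' he').trans ?_
      have : (e'.1.length : ℝ) ≤ R + 1 := by exact_mod_cast (h.len_le e' he').trans (Nat.le_succ R)
      nlinarith
    have hlen_e : (e.1.length : ℝ) * P.rho η + P.rho η ≤ (R + 1) * P.rho η := by
      have : (e.1.length : ℝ) ≤ R := by exact_mod_cast h.len_le e he
      nlinarith
    have herr_c : fro (hat P.p (P.cand e.2 i) - a i * wmat a e.1) ≤ (R + 1) * P.rho η :=
      (fro_hat_cand_sub_le hP hi hunit (h.err e he) (hlen_e.trans hR)).trans hlen_e
    -- the closeness test, transported to the true matrices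
    have hclose : phaseDist (hat P.p (P.cand e.2 i)) (hat P.p e'.2) ≤ 1 / P.T := (closeTest_eq_true_iff hT _ _).1 htest
    have hstep : phaseDist (a i * wmat a e.1) (wmat a e'.1) ≤ P.theta η R := by
      refine (phaseDist_le_add_fro (hat P.p (P.cand e.2 i)) (hat P.p e'.2) _ _).trans ?_
      rw [theta, fro_sub_comm (a i * wmat a e.1), fro_sub_comm (wmat a e'.1)]
      linarith
    refine ⟨e', he', ?_⟩
    rw [wmat_append_singleton, List.length_append, List.length_singleton]
    calc phaseDist (a i * wmat a v) (wmat a e'.1)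
        ≤ phaseDist (a i * wmat a v) (a i * wmat a e.1) + phaseDist (a i * wmat a e.1) (wmat a e'.1) :=
          phaseDist_triangle _ _ _
      _ ≤ v.length * P.theta η R + P.theta η R := by
          rw [phaseDist_unitary_mul (hP.unitary i hi)]; exact add_le_add hde hstep
      _ = ((v.length + 1 : ℕ) : ℝ) * P.theta η R := by push_cast; ring

/-! ### The lookup -/

/-- **Correctness of the lookup.** If some stored word is, up to phase and the approximation
errors, within `1/TT` of the unitary `U` represented by the target, then the lookup returns a
stored word `w` with `D(U, wmat w) ≤ 1/TT + η_T + E`. [cite: DawsonNielsen2006, §5] -/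
theorem lookup_spec {a : ℕ → Matrix (QReg m) (QReg m) ℂ} {TT : ℕ} (hTT : 0 < TT) {net : List (Elem m)}
    {E ηT : ℝ} (herr : ∀ e ∈ net, fro (hat P.p e.2 - wmat a e.1) ≤ E) {tgt : GMat m}
    {U : Matrix (QReg m) (QReg m) ℂ} (htgt : fro (hat P.p tgt - U) ≤ ηT)
    (hex : ∃ e ∈ net, phaseDist U (wmat a e.1) + ηT + E ≤ 1 / TT) :
    ∃ e ∈ net, e.1 = P.lookup TT net tgt ∧ phaseDist U (wmat a e.1) ≤ 1 / TT + ηT + E := by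
  obtain ⟨e₀, he₀, hd₀⟩ := hex
  have ht₀ : closeTest P.p TT tgt e₀.2 = true := by
    rw [closeTest_eq_true_iff hTT]
    refine le_trans ((phaseDist_le_add_fro U (wmat a e₀.1) _ _).trans ?_) hd₀
    exact add_le_add (add_le_add le_rfl htgt) (herr e₀ he₀)
  have hne : net.filter (fun e => closeTest P.p TT tgt e.2) ≠ [] := fun hnil =>
    absurd ht₀ (by simpa using (List.filter_eq_nil_iff.1 hnil) e₀ he₀)
  rcases hf : net.filter (fun e => closeTest P.p TT tgt e.2) with _ | ⟨e, es⟩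
  · exact absurd hf hne
  · have he : e ∈ net.filter (fun e => closeTest P.p TT tgt e.2) := by rw [hf]; exact List.mem_cons_self
    rw [List.mem_filter] at he
    refine ⟨e, he.1, by rw [lookup, hf], ?_⟩
    have hclose := (closeTest_eq_true_iff hTT _ _).1 he.2
    calc phaseDist U (wmat a e.1) ≤ phaseDist (hat P.p tgt) (hat P.p e.2) + fro (U - hat P.p tgt) + fro (wmat a e.1 - hat P.p e.2) :=
          phaseDist_le_add_fro _ _ _ _
      _ ≤ 1 / TT + ηT + E := by
          rw [fro_sub_comm U, fro_sub_comm (wmat a e.1)]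
          exact add_le_add (add_le_add hclose htgt) (herr e he.1)


/-! ### Summary: the compiled word -/

/-- **Adequate parameters** for a run of `R` rounds analysed at mesh `hm`: a genuine threshold,
a genuine mesh with `2 · 2ᵐ · hm · T ≤ 2ᵖ` (far matrices get different cells), enough rounds to
process a net of maximal size (`2 · packBound ≤ R`), and a precision making the accumulated
error `(R + 1) ρ ≤ 1`. [folklore] -/
structure Good (P : Params m) (η : ℝ) (R hm : ℕ) : Prop where
  /-- the separation threshold is genuine -/
  T_pos : 0 < P.T
  /-- the mesh is genuine -/
  h_pos : 0 < hm
  /-- far matrices get different cells -/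
  sep : 2 * (Fintype.card (QReg m) : ℝ) * hm * P.T ≤ 2 ^ P.p
  /-- enough rounds -/
  rounds : 2 * P.packBound hm ≤ R
  /-- enough precision -/
  small : ((R : ℝ) + 1) * P.rho η ≤ 1

/-- **The net after `R` rounds**, under adequate parameters: every stored word uses genuine
generators, has length `≤ R`, is represented within `(R + 1) ρ`; and every word over the
generators is within `|v| θ` of a stored word up to phase. [cite: DawsonNielsen2006, §5] -/
theorem run_spec {a : ℕ → Matrix (QReg m) (QReg m) ℂ} {η : ℝ} {R hm : ℕ} (hP : P.Approximates a η)
    (hG : P.Good η R hm) :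
    (∀ e ∈ (P.run R).2, (∀ i ∈ e.1, i < P.gens.length) ∧ e.1.length ≤ R ∧
      fro (hat P.p e.2 - wmat a e.1) ≤ (R + 1) * P.rho η) ∧
    ∀ v : List ℕ, (∀ i ∈ v, i < P.gens.length) →
      ∃ e ∈ (P.run R).2, phaseDist (wmat a v) (wmat a e.1) ≤ v.length * P.theta η R := by
  have hρ := P.rho_nonneg hP.nonneg
  have hR1 : (R : ℝ) * P.rho η ≤ 1 := le_trans (by nlinarith) hG.small
  have hinv := P.inv_run hP hR1
  have hI := hinv R le_rfl
  have hdone : (P.run R).1 = (P.run R).2.length :=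
    P.run_complete (fun r hr => (hinv r hr).ptr_le) (fun r hr => (hinv r hr).length_le hG.T_pos hG.h_pos hG.sep)
      hG.rounds
  refine ⟨fun e he => ⟨hI.idx_lt e he, hI.len_le e he, (hI.err e he).trans ?_⟩,
    hI.exists_phaseDist_wmat_le hP hdone hG.T_pos hG.small⟩
  have : (e.1.length : ℝ) ≤ R + 1 := by exact_mod_cast (hI.len_le e he).trans (Nat.le_succ R)
  nlinarith

/-- **The compiled word**: run the net construction for `R` rounds, then look the target up at
threshold `1/TT`. [cite: DawsonNielsen2006, §5] -/
def compile (R TT : ℕ) (tgt : GMat m) : List ℕ := P.lookup TT (P.run R).2 tgt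

/-- **Correctness of the compiled word.** Under adequate parameters, if the target represents the
unitary `U` within `η_T` and SOME word `v` over the generators is close enough to `U` up to phase
(this is where the Solovay–Kitaev theorem enters, with its length bound feeding `|v| θ`), then the
compiled word `w` uses genuine generators, has length `≤ R`, and
`D(U, wmat w) ≤ 1/TT + η_T + (R + 1) ρ`. [cite: DawsonNielsen2006, Thm. 1 and §5] -/
theorem compile_spec {a : ℕ → Matrix (QReg m) (QReg m) ℂ} {η : ℝ} {R hm TT : ℕ} (hP : P.Approximates a η)
    (hG : P.Good η R hm) (hTT : 0 < TT) {tgt : GMat m} {U : Matrix (QReg m) (QReg m) ℂ} {ηT : ℝ}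
    (htgt : fro (hat P.p tgt - U) ≤ ηT)
    (hv : ∃ v : List ℕ, (∀ i ∈ v, i < P.gens.length) ∧
      phaseDist U (wmat a v) + v.length * P.theta η R + ηT + (R + 1) * P.rho η ≤ 1 / TT) :
    (∀ i ∈ P.compile R TT tgt, i < P.gens.length) ∧ (P.compile R TT tgt).length ≤ R ∧
      phaseDist U (wmat a (P.compile R TT tgt)) ≤ 1 / TT + ηT + (R + 1) * P.rho η := by
  obtain ⟨hnet, hwords⟩ := P.run_spec hP hG
  obtain ⟨v, hv, hbound⟩ := hv
  obtain ⟨e, he, hde⟩ := hwords v hv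
  have hex : ∃ e ∈ (P.run R).2, phaseDist U (wmat a e.1) + ηT + (R + 1) * P.rho η ≤ 1 / TT :=
    ⟨e, he, le_trans (by linarith [phaseDist_triangle U (wmat a v) (wmat a e.1)]) hbound⟩
  obtain ⟨e', he', hew, hd⟩ := P.lookup_spec hTT (fun e he => (hnet e he).2.2) htgt hex
  rw [compile, ← hew]
  exact ⟨(hnet e' he').1, (hnet e' he').2.1, hd⟩

end Params

end NetCompiler

end Literature.Computability.QuantumComplexity

end
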